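import Mathlib.Analysis.Normed.Operator.Banach
import Mathlib.MeasureTheory.Function.LpSpace.Indicator
import Literature.Analysis.UnboundedOperators.SelfAdjointResolvent
import Literature.Analysis.OperatorTheory.NormalScalarSpectralMeasure
import HarnessLib

/-!
# The spectral theorem for a self-adjoint operator with a cyclic vector (multiplication-operator form)

RH-FREE library file (abstract operator theory; no positivity statement, no zeta).  **Reed–Simon I,
Thm VIII.4 (spectral theorem — multiplication operator form)** in the cyclic case: for a
self-adjoint `D : H →ₗ.[ℂ] H` (Mathlib `LinearPMap`, `IsSelfAdjoint D ↔ D† = D`) and a vector `ξ`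
all of whose iterates `Dʲξ` are defined and span a dense subspace, there are a finite measure `μ`
on `ℝ` (`μ(ℝ) = ‖ξ‖²`) and a unitary `U : H ≃ₗᵢ[ℂ] L²(ℝ, μ)` with `U ξ = 1`,
(a) `x ∈ dom D ↔ s·(Ux)(s) ∈ L²(μ)` and (b) `U(Dx) = s·Ux` (`exists_unitary_mul_model`).

The proof FOLLOWS REED–SIMON'S (pdf pp. 246–247 of the held copy), node by node:
* §1 `N := (D + i)⁻¹` (`resolventNegI`) is bounded, injective, normal, with range `dom D`
  (`Literature.Analysis.UnboundedOperators.SelfAdjointResolvent`);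
* §2 "the spectral theorem for bounded normal operators", cyclic case: the scalar spectral measure
  `ν` of `ξ` for `N` and the cyclic isometry `W : L²(ν) → H`, `W[f] = f(N)ξ`
  (`Literature.Analysis.OperatorTheory.NormalScalarSpectralMeasure`); "Since `Ker (A+i)⁻¹` is
  empty, `g ≠ 0` a.e." becomes `ν{0} = 0` (`resolventSpectralMeasure_singleton_zero`: `W 1_{0}`
  lies in `ker N`);
* §3 "f is real-valued": here obtained from `σ(N) ⊆ {0} ∪ {Im(1/w) = 1}`
  (`spectrum_resolventNegI_subset`, since `N − w = −w (D − z₀)(D + i)⁻¹` with `z₀ = 1/w − i`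
  non-real), so the symbol `f(w) = 1/w − i` of `D` is real `ν`-a.e. (`ae_inv_im_eq_one`);
* §4 clauses (a)/(b) in the `L²(ν)` model exactly as printed ("`ψ = (A+i)⁻¹φ` … `Uψ = g Uφ`";
  "`Aψ = φ − iψ`"): `resolventNegI_cyclicIsometry_inv_mul`, `memLp_inv_mul_of_mem_domain`,
  `map_cyclicIsometry_eq`;
* §5 the one place where CYCLICITY enters: `W` is onto, because its closed range reduces `N` and
  `N†`, hence (with `N` injective) is stable under `D` on `dom D`, hence contains every `Dʲξ`
  (`resolventCyclicIsometry_surjective`) — Reed–Simon's "direct sum of cyclic subspaces" collapses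
  to one summand;
* §6 transport of `L²(ℂ, ν)` to `L²(ℝ, μ)`, `μ := ν ∘ φ⁻¹` with `φ(w) = Re(1/w)` and inverse
  `χ(s) = (s + i)⁻¹` a.e. (`Lp.compMeasurePreservingₗᵢ` both ways), and assembly.

Application: `Literature.NumberTheory.ConnesConsani2024.CCM2024_thm_2_1_i_holds` (Connes–Consani–
Moscovici 2024 Thm 2.1 (i), "the canonical form of a cyclic pair", whose printed proof is "by the
spectral theorem").  Design: defs are `abbrev`s over the two library files (no new structures, no
instances, no notation); the measure on `ℝ` is a plain push-forward so that its total mass and the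
model identities are one-line consequences of the `ℂ`-side statements.

## References
* M. Reed, B. Simon, *Methods of Modern Mathematical Physics I: Functional Analysis* (rev. ed.
  1980), §VII.2 Lemma 1, §VIII.3 Thm VIII.4 and its proof (pdf pp. 246–247). [ReedSimonI1980]
-/

noncomputable section

open _root_.MeasureTheory _root_.Filter _root_.Topology
open scoped InnerProductSpace NNReal ENNReal ComplexConjugate

namespace Literature.Analysis.UnboundedOperators

open Literature.Analysis.OperatorTheory _root_.MeasureTheory _root_.Complex

variable {H : Type*} [NormedAddCommGroup H] [InnerProductSpace ℂ H] [CompleteSpace H]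
variable {D : H →ₗ.[ℂ] H}

/-! ## §1 The resolvent `N = (D + i)⁻¹` -/

/-- `Im(−i) ≠ 0` (plumbing). [cite: ReedSimonI1980, Thm VIII.4 (proof)] -/
theorem neg_I_im_ne_zero : (-Complex.I).im ≠ 0 := by simp

/-- The bounded normal operator `N = (D + i)⁻¹ = R(−i)` of Reed–Simon's proof of Thm VIII.4.
[cite: ReedSimonI1980, Thm VIII.4 (proof)] -/
abbrev resolventNegI (hD : IsSelfAdjoint D) : H →L[ℂ] H := resolvent hD neg_I_im_ne_zero

/-- `N = (D + i)⁻¹` is normal. [cite: ReedSimonI1980, Thm VIII.4 (proof)] -/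
theorem isStarNormal_resolventNegI (hD : IsSelfAdjoint D) : IsStarNormal (resolventNegI hD) :=
  isStarNormal_resolvent hD _

/-- `D (N y) = y − i N y`. [cite: ReedSimonI1980, Thm VIII.4 (proof)] -/
theorem map_resolventNegI (hD : IsSelfAdjoint D) (y : H) :
    (D ⟨resolventNegI hD y, resolvent_mem_domain hD _ y⟩ : H) = y - Complex.I • resolventNegI hD y := by
  rw [map_resolvent hD neg_I_im_ne_zero y, neg_smul, sub_eq_add_neg]

/-- `N (D x + i x) = x` for `x ∈ dom D`. [cite: ReedSimonI1980, Thm VIII.4 (proof)] -/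
theorem resolventNegI_map_add (hD : IsSelfAdjoint D) (x : D.domain) :
    resolventNegI hD ((D x : H) + Complex.I • (x : H)) = x := by
  have h := resolvent_sub_smul hD neg_I_im_ne_zero x
  rwa [neg_smul, sub_neg_eq_add] at h

/-! ## §2 The spectral measure of `ξ` for `N` and the cyclic isometry -/

section Model

variable (hD : IsSelfAdjoint D) (ξ : H)

/-- The scalar spectral measure `ν` of `ξ` for the normal operator `N = (D + i)⁻¹` (the measure
`μ` on `M = σ(N)` of Reed–Simon's proof of Thm VIII.4, cyclic case). [cite: ReedSimonI1980, Thm VIII.4 (proof)] -/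
abbrev resolventSpectralMeasure : Measure ℂ :=
  normalSpectralMeasure (resolventNegI hD) (isStarNormal_resolventNegI hD) ξ

/-- The cyclic isometry `W : L²(ν) → H`, `W [f] = f(N) ξ`. [cite: ReedSimonI1980, Thm VIII.4 (proof)] -/
abbrev resolventCyclicIsometry :
    Lp ℂ 2 (resolventSpectralMeasure hD ξ) →ₗᵢ[ℂ] H :=
  cyclicIsometry (resolventNegI hD) (isStarNormal_resolventNegI hD) ξ

/-- **`ν({0}) = 0`**: "Since `Ker (A + i)⁻¹` is empty, `g(m) ≠ 0` a.e. `[μ]`" (Reed–Simon I, proof of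
Thm VIII.4) — here: `W 1_{0} ∈ ker N = 0`, and `W` is isometric. [cite: ReedSimonI1980, Thm VIII.4 (proof)] -/
theorem resolventSpectralMeasure_singleton_zero : resolventSpectralMeasure hD ξ {0} = 0 := by
  set ν := resolventSpectralMeasure hD ξ with hν
  set N := resolventNegI hD with hN
  set W := resolventCyclicIsometry hD ξ with hW
  have hs : MeasurableSet ({0} : Set ℂ) := measurableSet_singleton 0
  set u₀ : Lp ℂ 2 ν := indicatorConstLp 2 hs (measure_ne_top ν _) (1 : ℂ) with hu₀
  -- `N (W u₀) = W 0 = 0`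
  have h0 : ((0 : Lp ℂ 2 ν) : ℂ → ℂ) =ᵐ[ν] fun z => z * u₀ z := by
    filter_upwards [Lp.coeFn_zero ℂ 2 ν, indicatorConstLp_coeFn (p := 2) (hs := hs)
      (hμs := measure_ne_top ν _) (c := (1 : ℂ))] with z hz hz'
    rw [hz, hz']
    by_cases hz0 : z = 0
    · simp [hz0]
    · simp [Set.indicator_of_notMem (show z ∉ ({0} : Set ℂ) from hz0)]
  have h1 : W 0 = N (W u₀) := cyclicIsometry_of_ae_eq_id_mul _ _ ξ h0
  rw [map_zero] at h1
  have h2 : W u₀ = 0 := resolvent_injective hD _ (by rw [← h1, map_zero])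
  have h3 : u₀ = 0 := by
    have : ‖u₀‖ = 0 := by rw [← (resolventCyclicIsometry hD ξ).norm_map u₀, ← hW, h2, norm_zero]
    exact norm_eq_zero.1 this
  have h4 : ‖u₀‖ = ‖(1 : ℂ)‖ * (ν {0}).toReal ^ (1 / (2 : ℝ≥0∞).toReal) := by
    rw [hu₀]; exact norm_indicatorConstLp (by norm_num) ENNReal.ofNat_ne_top
  rw [h3, norm_zero, norm_one, one_mul] at h4
  have h5 : (ν {0}).toReal = 0 :=
    ((Real.rpow_eq_zero_iff_of_nonneg ENNReal.toReal_nonneg).1 h4.symm).1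
  exact ((ENNReal.toReal_eq_zero_iff _).1 h5).resolve_right (measure_ne_top ν _)

/-- `ν`-almost every point is non-zero. [cite: ReedSimonI1980, Thm VIII.4 (proof)] -/
theorem ae_ne_zero_resolventSpectralMeasure :
    ∀ᵐ z ∂(resolventSpectralMeasure hD ξ), z ≠ 0 := by
  have h := resolventSpectralMeasure_singleton_zero hD ξ
  rw [← compl_mem_ae_iff] at h
  filter_upwards [h] with z hz
  simpa using hz

/-! ## §3 The spectrum of `N` lies on the circle `{Im(1/w) = 1} ∪ {0}`, so `1/w − i` is real a.e. -/

/-- For `w ≠ 0` off the circle `Im(1/w) = 1`, the operator `N − w` is invertible: it equals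
`−w (D − z₀) (D + i)⁻¹` with `z₀ = 1/w − i` non-real (the computation behind "f is real-valued" in
Reed–Simon's proof of Thm VIII.4, done here through the resolvent instead of through the measure).
[cite: ReedSimonI1980, Thm VIII.4 (proof)] -/
theorem spectrum_resolventNegI_subset :
    spectrum ℂ (resolventNegI hD) ⊆ {0} ∪ {w : ℂ | (w⁻¹).im = 1} := by
  intro w hw
  by_contra hcon
  simp only [Set.mem_union, Set.mem_singleton_iff, Set.mem_setOf_eq, not_or] at hcon
  obtain ⟨hw0, hw1⟩ := hcon
  set N := resolventNegI hD with hN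
  -- `z₀ = 1/w − i` is non-real
  set z₀ : ℂ := w⁻¹ - Complex.I with hz₀
  have hz₀im : z₀.im ≠ 0 := by
    rw [hz₀, Complex.sub_im, Complex.I_im]
    exact sub_ne_zero.2 hw1
  -- the bijection `y ↦ (D − z₀) (N y) = y − w⁻¹ N y`
  set L : H ≃ₗ[ℂ] H := (subSMulEquiv hD neg_I_im_ne_zero).symm.trans (subSMulEquiv hD hz₀im)
    with hL
  have hLapply : ∀ y, L y = y - w⁻¹ • N y := by
    intro y
    rw [hL, LinearEquiv.trans_apply, subSMulEquiv_apply]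
    have h1 : ((subSMulEquiv hD neg_I_im_ne_zero).symm y : H) = N y := rfl
    have h2 : (D ((subSMulEquiv hD neg_I_im_ne_zero).symm y) : H) = y - Complex.I • N y := by
      have := map_resolventNegI hD y
      exact this
    rw [h1, h2, hz₀, sub_smul]
    abel
  -- hence `1 − w⁻¹ N` is bijective, so a unit; and `w − N = w (1 − w⁻¹ N)`
  set T : H →L[ℂ] H := 1 - w⁻¹ • N with hT
  have hTapply : ∀ y, T y = L y := by
    intro y; rw [hLapply, hT]; rfl
  have hTbij : Function.Bijective T := by
    have : (T : H → H) = L := funext hTapply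
    rw [this]; exact L.bijective
  have hTunit : IsUnit T := ContinuousLinearMap.isUnit_iff_bijective.2 hTbij
  have hwunit : IsUnit (algebraMap ℂ (H →L[ℂ] H) w) := (isUnit_iff_ne_zero.2 hw0).map _
  have hprod : algebraMap ℂ (H →L[ℂ] H) w - N = algebraMap ℂ (H →L[ℂ] H) w * T := by
    rw [hT, mul_sub, mul_one, Algebra.algebraMap_eq_smul_one, smul_mul_assoc, one_mul,
      smul_smul, mul_inv_cancel₀ hw0, one_smul]
  rw [spectrum.mem_iff] at hw
  exact hw (hprod ▸ hwunit.mul hTunit)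

/-- **`1/w − i` is real `ν`-a.e.** ("Thus `f` is real-valued", Reed–Simon I, proof of Thm VIII.4):
`Im(1/w) = 1` for `ν`-almost every `w`. [cite: ReedSimonI1980, Thm VIII.4 (proof)] -/
theorem ae_inv_im_eq_one :
    ∀ᵐ w ∂(resolventSpectralMeasure hD ξ), (w⁻¹).im = 1 := by
  filter_upwards [ae_mem_spectrum_normalSpectralMeasure (resolventNegI hD)
    (isStarNormal_resolventNegI hD) ξ, ae_ne_zero_resolventSpectralMeasure hD ξ] with w hw hw0
  have h := spectrum_resolventNegI_subset hD hw
  simp only [Set.mem_union, Set.mem_singleton_iff, Set.mem_setOf_eq] at h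
  exact h.resolve_left hw0

/-! ## §4 `dom D` and `D` in the `L²(ν)` model (clauses (a) and (b) of Reed–Simon's Thm VIII.4 for
the symbol `f(w) = 1/w − i` of `N`) -/

/-- If `w ↦ u(w)/w ∈ L²(ν)` then `N (W [u/w]) = W u`; in particular `W u ∈ dom D`
("Conversely, if `f(Uψ) ∈ L²` … `ψ = (A+i)⁻¹φ`", Reed–Simon I, proof of Thm VIII.4 (a)).
[cite: ReedSimonI1980, Thm VIII.4 (proof)] -/
theorem resolventNegI_cyclicIsometry_inv_mul (u : Lp ℂ 2 (resolventSpectralMeasure hD ξ))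
    (hm : MemLp (fun w => w⁻¹ * u w) 2 (resolventSpectralMeasure hD ξ)) :
    resolventNegI hD (resolventCyclicIsometry hD ξ (hm.toLp _)) = resolventCyclicIsometry hD ξ u := by
  symm
  refine cyclicIsometry_of_ae_eq_id_mul _ _ ξ ?_
  filter_upwards [hm.coeFn_toLp, ae_ne_zero_resolventSpectralMeasure hD ξ] with w hw hw0
  rw [hw, ← mul_assoc, mul_inv_cancel₀ hw0, one_mul]

/-- Under the same hypothesis, `W u ∈ dom D`. [cite: ReedSimonI1980, Thm VIII.4 (proof)] -/
theorem cyclicIsometry_mem_domain_of_memLp (u : Lp ℂ 2 (resolventSpectralMeasure hD ξ))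
    (hm : MemLp (fun w => w⁻¹ * u w) 2 (resolventSpectralMeasure hD ξ)) :
    (resolventCyclicIsometry hD ξ u : H) ∈ D.domain := by
  rw [← resolventNegI_cyclicIsometry_inv_mul hD ξ u hm]
  exact resolvent_mem_domain hD _ _

/-- **Clause (b) in the `L²(ν)` model**: `D (W u) = W [u/w] − i W u`, i.e. `D` acts as
multiplication by `f(w) = 1/w − i` ("`(UAψ)(m) = (g(m)⁻¹ − i)(Uψ)(m)`", Reed–Simon I, proof of
Thm VIII.4 (b)). [cite: ReedSimonI1980, Thm VIII.4 (proof)] -/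
theorem map_cyclicIsometry_eq (u : Lp ℂ 2 (resolventSpectralMeasure hD ξ))
    (hm : MemLp (fun w => w⁻¹ * u w) 2 (resolventSpectralMeasure hD ξ))
    (hx : (resolventCyclicIsometry hD ξ u : H) ∈ D.domain) :
    (D ⟨resolventCyclicIsometry hD ξ u, hx⟩ : H) =
      resolventCyclicIsometry hD ξ (hm.toLp _) - Complex.I • resolventCyclicIsometry hD ξ u := by
  have h1 := map_resolventNegI hD (resolventCyclicIsometry hD ξ (hm.toLp _))
  have h2 := resolventNegI_cyclicIsometry_inv_mul hD ξ u hm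
  have h3 : (⟨resolventCyclicIsometry hD ξ u, hx⟩ : D.domain) =
      ⟨resolventNegI hD (resolventCyclicIsometry hD ξ (hm.toLp _)), resolvent_mem_domain hD _ _⟩ :=
    Subtype.ext h2.symm
  rw [h3, h1, h2]

/-- The `L²` class `[u/w] − i u` represents `(1/w − i) u`. [cite: ReedSimonI1980, Thm VIII.4 (proof)] -/
theorem coeFn_toLp_inv_mul_sub (u : Lp ℂ 2 (resolventSpectralMeasure hD ξ))
    (hm : MemLp (fun w => w⁻¹ * u w) 2 (resolventSpectralMeasure hD ξ)) :
    ((hm.toLp _ - Complex.I • u : Lp ℂ 2 (resolventSpectralMeasure hD ξ)) : ℂ → ℂ)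
      =ᵐ[resolventSpectralMeasure hD ξ] fun w => (w⁻¹ - Complex.I) * u w := by
  filter_upwards [Lp.coeFn_sub (hm.toLp _) (Complex.I • u), Lp.coeFn_smul Complex.I u,
    hm.coeFn_toLp] with w h1 h2 h3
  rw [h1, Pi.sub_apply, h2, Pi.smul_apply, h3, smul_eq_mul, sub_mul]

/-- **Clause (a), direction `⇒`, in the `L²(ν)` model**: if `W u ∈ dom D` and `W` is onto, then
`u/w ∈ L²(ν)` ("`ψ = (A+i)⁻¹φ` … `Uψ = g Uφ`. Since `fg` is bounded … `f(Uψ) ∈ L²`", Reed–Simon I,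
proof of Thm VIII.4 (a)). [cite: ReedSimonI1980, Thm VIII.4 (proof)] -/
theorem memLp_inv_mul_of_mem_domain (hW : Function.Surjective (resolventCyclicIsometry hD ξ))
    (u : Lp ℂ 2 (resolventSpectralMeasure hD ξ))
    (hx : (resolventCyclicIsometry hD ξ u : H) ∈ D.domain) :
    MemLp (fun w => w⁻¹ * u w) 2 (resolventSpectralMeasure hD ξ) := by
  obtain ⟨y, hy⟩ := (mem_domain_iff_exists_resolvent hD neg_I_im_ne_zero _).1 hx
  obtain ⟨h, hh⟩ := hW y
  -- `W u = N (W h) = W (w h)`, so `u = w h` a.e. and `u / w = h` a.e.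
  have hvae := coeFn_spectralMulL2 (resolventNegI hD) (isStarNormal_resolventNegI hD) ξ
    continuous_id h
  have h1 := cyclicIsometry_of_ae_eq_id_mul _ _ ξ hvae
  have h2 : resolventCyclicIsometry hD ξ
      (spectralMulL2 (resolventNegI hD) (isStarNormal_resolventNegI hD) ξ continuous_id h) =
      resolventCyclicIsometry hD ξ u := by
    rw [h1]
    change resolvent hD neg_I_im_ne_zero (resolventCyclicIsometry hD ξ h) = _
    rw [hh]; exact hy
  have h3 := (resolventCyclicIsometry hD ξ).injective h2
  have h4 : (fun w => w⁻¹ * u w) =ᵐ[resolventSpectralMeasure hD ξ] (h : ℂ → ℂ) := by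
    filter_upwards [hvae, ae_ne_zero_resolventSpectralMeasure hD ξ] with w hw hw0
    rw [← h3, hw, id, ← mul_assoc, inv_mul_cancel₀ hw0, one_mul]
  exact (Lp.memLp h).ae_eq h4.symm

end Model

/-! ## §5 Cyclicity: `W` is onto when the iterates `Dʲ ξ` span a dense subspace -/

section Cyclic

variable (hD : IsSelfAdjoint D) (ξ : H)

/-- The range of `W` is invariant under `N`. [cite: ReedSimonI1980, §VII.2 Lemma 1] -/
theorem resolventNegI_mem_range (x : H) (hx : x ∈ Set.range (resolventCyclicIsometry hD ξ)) :
    resolventNegI hD x ∈ Set.range (resolventCyclicIsometry hD ξ) := by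
  obtain ⟨u, rfl⟩ := hx
  refine ⟨spectralMulL2 _ (isStarNormal_resolventNegI hD) ξ continuous_id u, ?_⟩
  exact cyclicIsometry_of_ae_eq_id_mul _ _ ξ
    (coeFn_spectralMulL2 _ (isStarNormal_resolventNegI hD) ξ continuous_id u)

/-- The range of `W` is invariant under `N†`. [cite: ReedSimonI1980, §VII.2 Lemma 1] -/
theorem adjoint_resolventNegI_mem_range (x : H) (hx : x ∈ Set.range (resolventCyclicIsometry hD ξ)) :
    ContinuousLinearMap.adjoint (resolventNegI hD) x ∈ Set.range (resolventCyclicIsometry hD ξ) := by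
  obtain ⟨u, rfl⟩ := hx
  refine ⟨spectralMulL2 _ (isStarNormal_resolventNegI hD) ξ continuous_star u, ?_⟩
  exact cyclicIsometry_of_ae_eq_conj_mul _ _ ξ
    (coeFn_spectralMulL2 _ (isStarNormal_resolventNegI hD) ξ continuous_star u)

/-- The range of `W`, as a closed submodule. [cite: ReedSimonI1980, §VII.2 Lemma 1] -/
abbrev rangeW : Submodule ℂ H := LinearMap.range (resolventCyclicIsometry hD ξ).toLinearMap

/-- `x ∈ range W ∩ dom D ⇒ D x ∈ range W` (the range reduces `N` and `N†`, and `N` is injective).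
[cite: ReedSimonI1980, Thm VIII.4 (proof)] -/
theorem map_mem_range (x : D.domain) (hx : (x : H) ∈ Set.range (resolventCyclicIsometry hD ξ)) :
    (D x : H) ∈ Set.range (resolventCyclicIsometry hD ξ) := by
  set N := resolventNegI hD with hN
  set S : Submodule ℂ H := rangeW hD ξ with hS
  have hSeq : (S : Set H) = Set.range (resolventCyclicIsometry hD ξ) := LinearMap.coe_range _
  have hSclosed : IsClosed (S : Set H) := by rw [hSeq]; exact isClosed_range_cyclicIsometry _ _ ξ
  haveI : CompleteSpace S := hSclosed.completeSpace_coe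
  haveI : S.HasOrthogonalProjection := Submodule.HasOrthogonalProjection.ofCompleteSpace S
  -- `y := D x + i x`, `N y = x`
  set y : H := (D x : H) + Complex.I • (x : H) with hy
  have hNy : N y = x := resolventNegI_map_add hD x
  -- decompose `y = y₁ + y₂`
  set y₁ : H := (S.starProjection y : H) with hy₁
  set y₂ : H := y - y₁ with hy₂
  have hy₁S : y₁ ∈ S := Submodule.starProjection_apply_mem S y
  have hy₂S : y₂ ∈ Sᗮ := Submodule.sub_starProjection_mem_orthogonal y
  have hNy₁ : N y₁ ∈ S := by
    rw [← SetLike.mem_coe, hSeq]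
    exact resolventNegI_mem_range hD ξ y₁ (by rw [← hSeq]; exact hy₁S)
  -- `N y₂ ∈ Sᗮ`
  have hNy₂ : N y₂ ∈ Sᗮ := by
    rw [Submodule.mem_orthogonal]
    intro s hs
    have hs' : ContinuousLinearMap.adjoint N s ∈ S := by
      rw [← SetLike.mem_coe, hSeq]
      exact adjoint_resolventNegI_mem_range hD ξ s (by rw [← hSeq]; exact hs)
    rw [← ContinuousLinearMap.adjoint_inner_left]
    exact (Submodule.mem_orthogonal S y₂).1 hy₂S _ hs'
  -- `N y₂ = x − N y₁ ∈ S`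
  have hxS : (x : H) ∈ S := by rw [← SetLike.mem_coe, hSeq]; exact hx
  have hNy₂S : N y₂ ∈ S := by
    have : N y₂ = (x : H) - N y₁ := by
      rw [hy₂, map_sub, hNy]
    rw [this]; exact S.sub_mem hxS hNy₁
  have hNy₂0 : N y₂ = 0 := by
    have := (Submodule.mem_orthogonal S (N y₂)).1 hNy₂ _ hNy₂S
    exact inner_self_eq_zero.1 this
  have hy₂0 : y₂ = 0 := resolvent_injective hD _ (by rw [hNy₂0, map_zero])
  have hyS : y ∈ S := by
    have : y = y₁ := by rw [← sub_eq_zero]; exact hy₂0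
    rw [this]; exact hy₁S
  have hDx : (D x : H) = y - Complex.I • (x : H) := by rw [hy]; abel
  rw [← hSeq, SetLike.mem_coe, hDx]
  exact S.sub_mem hyS (S.smul_mem _ hxS)

/-- **The cyclic isometry is onto** when `ξ` is a cyclic vector: the iterates `Dʲξ` all lie in the
closed range of `W` (induction, using `map_mem_range`), and they span a dense subspace
(Reed–Simon I §VII.2 Lemma 1: "`U` … onto `ℋ_ψ`" for the cyclic subspace; §VIII.3). [cite: ReedSimonI1980, §VII.2 Lemma 1; Thm VIII.4 (proof)] -/
theorem resolventCyclicIsometry_surjective (v : ℕ → D.domain) (hv0 : (v 0 : H) = ξ)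
    (hvs : ∀ j, (v (j + 1) : H) = D (v j))
    (hd : Dense (Submodule.span ℂ (Set.range fun j => (v j : H)) : Set H)) :
    Function.Surjective (resolventCyclicIsometry hD ξ) := by
  set S : Submodule ℂ H := rangeW hD ξ with hS
  have hSeq : (S : Set H) = Set.range (resolventCyclicIsometry hD ξ) := LinearMap.coe_range _
  have hSclosed : IsClosed (S : Set H) := by rw [hSeq]; exact isClosed_range_cyclicIsometry _ _ ξ
  -- all iterates lie in `S`
  have hmem : ∀ j, (v j : H) ∈ Set.range (resolventCyclicIsometry hD ξ) := by
    intro j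
    induction j with
    | zero =>
      rw [hv0]
      exact ⟨_, cyclicIsometry_toSpectralL2_one _ _ ξ⟩
    | succ j ih =>
      rw [hvs j]
      exact map_mem_range hD ξ (v j) ih
  have hspan : Submodule.span ℂ (Set.range fun j => (v j : H)) ≤ S := by
    rw [Submodule.span_le]
    rintro _ ⟨j, rfl⟩
    rw [hSeq]; exact hmem j
  have hdense : Dense (S : Set H) := hd.mono hspan
  have htop : (S : Set H) = Set.univ := by
    rw [← hSclosed.closure_eq, hdense.closure_eq]
  intro x
  have hx : x ∈ (S : Set H) := by rw [htop]; trivial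
  rw [hSeq] at hx
  exact hx

end Cyclic

/-! ## §6 Transport to `ℝ` and the theorem -/

section Transport

/-- The real coordinate `φ(w) = Re(1/w)` (`= 1/w − i` a.e.). [cite: ReedSimonI1980, Thm VIII.4 (proof)] -/
def realSymbol (w : ℂ) : ℝ := (w⁻¹).re

/-- The inverse parametrisation `χ(s) = (s + i)⁻¹` of the circle `Im(1/w) = 1`. [cite: ReedSimonI1980, Thm VIII.4 (proof)] -/
def circleParam (s : ℝ) : ℂ := ((s : ℂ) + Complex.I)⁻¹

/-- `φ` is measurable. [cite: ReedSimonI1980, Thm VIII.4 (proof)] -/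
theorem measurable_realSymbol : Measurable realSymbol :=
  Complex.measurable_re.comp measurable_inv

/-- `χ` is continuous. [cite: ReedSimonI1980, Thm VIII.4 (proof)] -/
theorem continuous_circleParam : Continuous circleParam := by
  refine (Complex.continuous_ofReal.add continuous_const).inv₀ ?_
  intro s h
  have := congrArg Complex.im h
  simp at this

/-- `φ (χ s) = s`. [cite: ReedSimonI1980, Thm VIII.4 (proof)] -/
theorem realSymbol_circleParam (s : ℝ) : realSymbol (circleParam s) = s := by
  simp [realSymbol, circleParam]

/-- On the circle, `χ (φ w) = w`. [cite: ReedSimonI1980, Thm VIII.4 (proof)] -/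
theorem circleParam_realSymbol {w : ℂ} (hw : (w⁻¹).im = 1) : circleParam (realSymbol w) = w := by
  have h : ((realSymbol w : ℝ) : ℂ) + Complex.I = w⁻¹ := by
    apply Complex.ext <;> simp [realSymbol, hw]
  rw [circleParam, h, inv_inv]

/-- On the circle, `φ w = 1/w − i` as complex numbers. [cite: ReedSimonI1980, Thm VIII.4 (proof)] -/
theorem realSymbol_eq {w : ℂ} (hw : (w⁻¹).im = 1) : ((realSymbol w : ℝ) : ℂ) = w⁻¹ - Complex.I := by
  apply Complex.ext <;> simp [realSymbol, hw]

end Transport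

section Main

variable (hD : IsSelfAdjoint D) (ξ : H)

/-- The measure on `ℝ`: push-forward of `ν` along `φ`. [cite: ReedSimonI1980, Thm VIII.4] -/
abbrev realSpectralMeasure : Measure ℝ := (resolventSpectralMeasure hD ξ).map realSymbol

/-- `φ` is measure preserving `ν → μ`. [cite: ReedSimonI1980, Thm VIII.4 (proof)] -/
theorem measurePreserving_realSymbol :
    MeasurePreserving realSymbol (resolventSpectralMeasure hD ξ) (realSpectralMeasure hD ξ) :=
  ⟨measurable_realSymbol, rfl⟩

/-- `χ ∘ φ = id` `ν`-a.e. [cite: ReedSimonI1980, Thm VIII.4 (proof)] -/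
theorem ae_circleParam_realSymbol :
    ∀ᵐ w ∂(resolventSpectralMeasure hD ξ), circleParam (realSymbol w) = w := by
  filter_upwards [ae_inv_im_eq_one hD ξ] with w hw using circleParam_realSymbol hw

/-- `χ` is measure preserving `μ → ν`. [cite: ReedSimonI1980, Thm VIII.4 (proof)] -/
theorem measurePreserving_circleParam :
    MeasurePreserving circleParam (realSpectralMeasure hD ξ) (resolventSpectralMeasure hD ξ) := by
  refine ⟨continuous_circleParam.measurable, ?_⟩
  rw [Measure.map_map continuous_circleParam.measurable measurable_realSymbol]
  have h : (circleParam ∘ realSymbol) =ᵐ[resolventSpectralMeasure hD ξ] id :=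
    ae_circleParam_realSymbol hD ξ
  rw [Measure.map_congr h, Measure.map_id]

/-- The transport `L²(μ) → L²(ν)`, `G ↦ G ∘ φ`. [cite: ReedSimonI1980, Thm VIII.4 (proof)] -/
abbrev transportToC : Lp ℂ 2 (realSpectralMeasure hD ξ) →ₗᵢ[ℂ] Lp ℂ 2 (resolventSpectralMeasure hD ξ) :=
  Lp.compMeasurePreservingₗᵢ ℂ realSymbol (measurePreserving_realSymbol hD ξ)

/-- The transport `L²(ν) → L²(μ)`, `h ↦ h ∘ χ`. [cite: ReedSimonI1980, Thm VIII.4 (proof)] -/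
abbrev transportToR : Lp ℂ 2 (resolventSpectralMeasure hD ξ) →ₗᵢ[ℂ] Lp ℂ 2 (realSpectralMeasure hD ξ) :=
  Lp.compMeasurePreservingₗᵢ ℂ circleParam (measurePreserving_circleParam hD ξ)

/-- `(G ∘ φ) ∘ χ = G`: `transportToC` has left inverse `transportToR`… more precisely
`transportToC (transportToR h) = h`. [cite: ReedSimonI1980, Thm VIII.4 (proof)] -/
theorem transportToC_transportToR (h : Lp ℂ 2 (resolventSpectralMeasure hD ξ)) :
    transportToC hD ξ (transportToR hD ξ h) = h := by
  apply Lp.ext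
  have h1 : ((transportToC hD ξ (transportToR hD ξ h) : Lp ℂ 2 (resolventSpectralMeasure hD ξ)) : ℂ → ℂ)
      =ᵐ[resolventSpectralMeasure hD ξ]
      ((transportToR hD ξ h : Lp ℂ 2 (realSpectralMeasure hD ξ)) : ℝ → ℂ) ∘ realSymbol :=
    Lp.coeFn_compMeasurePreserving _ _
  have h2 : ((transportToR hD ξ h : Lp ℂ 2 (realSpectralMeasure hD ξ)) : ℝ → ℂ)
      =ᵐ[realSpectralMeasure hD ξ] (h : ℂ → ℂ) ∘ circleParam :=
    Lp.coeFn_compMeasurePreserving h (measurePreserving_circleParam hD ξ)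
  have h3 : ((transportToR hD ξ h : Lp ℂ 2 (realSpectralMeasure hD ξ)) : ℝ → ℂ) ∘ realSymbol
      =ᵐ[resolventSpectralMeasure hD ξ] ((h : ℂ → ℂ) ∘ circleParam) ∘ realSymbol :=
    ae_eq_comp measurable_realSymbol.aemeasurable h2
  filter_upwards [h1, h3, ae_circleParam_realSymbol hD ξ] with w hw1 hw3 hw4
  rw [hw1, hw3, Function.comp_apply, Function.comp_apply, hw4]

/-- `transportToC` is onto. [cite: ReedSimonI1980, Thm VIII.4 (proof)] -/
theorem transportToC_surjective : Function.Surjective (transportToC hD ξ) :=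
  fun h => ⟨transportToR hD ξ h, transportToC_transportToR hD ξ h⟩

include hD in
/-- **Spectral theorem, multiplication-operator form, cyclic case** (Reed–Simon I Thm VIII.4 with
§VII.2 Lemma 1): for a self-adjoint operator `D` on a complex Hilbert space and a vector `ξ`
whose iterates `Dʲξ` (all defined) span a dense subspace, there are a finite measure `μ` on `ℝ`
with `μ(ℝ) = ‖ξ‖²` and a unitary `U : H → L²(ℝ, μ)` with `U ξ = 1`,
(a) `x ∈ dom D ↔ s · (U x)(s) ∈ L²(μ)`, and (b) `U (D x) = s · U x` for `x ∈ dom D`.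
[cite: ReedSimonI1980, Thm VIII.4] -/
theorem exists_unitary_mul_model (v : ℕ → D.domain) (hv0 : (v 0 : H) = ξ)
    (hvs : ∀ j, (v (j + 1) : H) = D (v j))
    (hd : Dense (Submodule.span ℂ (Set.range fun j => (v j : H)) : Set H)) :
    ∃ (μ : Measure ℝ) (U : H ≃ₗᵢ[ℂ] Lp ℂ 2 μ), IsFiniteMeasure μ ∧
      μ Set.univ = ENNReal.ofReal (‖ξ‖ ^ 2) ∧
      ((U ξ : Lp ℂ 2 μ) : ℝ → ℂ) =ᵐ[μ] (fun _ => 1) ∧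
      (∀ x : H, x ∈ D.domain ↔ MemLp (fun s : ℝ => (s : ℂ) * ((U x : Lp ℂ 2 μ) : ℝ → ℂ) s) 2 μ) ∧
      (∀ x : D.domain, ((U (D x) : Lp ℂ 2 μ) : ℝ → ℂ) =ᵐ[μ]
        fun s => (s : ℂ) * ((U (x : H) : Lp ℂ 2 μ) : ℝ → ℂ) s) := by
  set ν := resolventSpectralMeasure hD ξ with hν
  set μ := realSpectralMeasure hD ξ with hμ
  set N := resolventNegI hD with hN
  have hWs := resolventCyclicIsometry_surjective hD ξ v hv0 hvs hd
  set W : Lp ℂ 2 ν ≃ₗᵢ[ℂ] H := LinearIsometryEquiv.ofSurjective (resolventCyclicIsometry hD ξ) hWs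
    with hW
  have hWap : ∀ u, W u = resolventCyclicIsometry hD ξ u := fun u => rfl
  set E : Lp ℂ 2 μ ≃ₗᵢ[ℂ] Lp ℂ 2 ν :=
    LinearIsometryEquiv.ofSurjective (transportToC hD ξ) (transportToC_surjective hD ξ) with hE
  have hEap : ∀ G, E G = transportToC hD ξ G := fun G => rfl
  have hEsymm : ∀ h, E.symm h = transportToR hD ξ h := by
    intro h
    apply E.injective
    rw [E.apply_symm_apply, hEap, transportToC_transportToR]
  set U : H ≃ₗᵢ[ℂ] Lp ℂ 2 μ := (E.trans W).symm with hU
  have hUap : ∀ x, U x = transportToR hD ξ (W.symm x) := by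
    intro x
    rw [hU]
    change E.symm (W.symm x) = _
    rw [hEsymm]
  -- the basic a.e. identities
  have hUae : ∀ x, ((U x : Lp ℂ 2 μ) : ℝ → ℂ) =ᵐ[μ] ((W.symm x : Lp ℂ 2 ν) : ℂ → ℂ) ∘ circleParam := by
    intro x
    rw [hUap]
    exact Lp.coeFn_compMeasurePreserving _ _
  have hφae : ∀ᵐ w ∂ν, ((realSymbol w : ℝ) : ℂ) = w⁻¹ - Complex.I := by
    filter_upwards [ae_inv_im_eq_one hD ξ] with w hw using realSymbol_eq hw
  -- pulling back along `φ`: `(U x) ∘ φ = W.symm x` a.e.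
  have hpull : ∀ x, (((U x : Lp ℂ 2 μ) : ℝ → ℂ) ∘ realSymbol) =ᵐ[ν]
      ((W.symm x : Lp ℂ 2 ν) : ℂ → ℂ) := by
    intro x
    have h1 : (((U x : Lp ℂ 2 μ) : ℝ → ℂ) ∘ realSymbol) =ᵐ[ν]
        (((W.symm x : Lp ℂ 2 ν) : ℂ → ℂ) ∘ circleParam) ∘ realSymbol :=
      ae_eq_comp measurable_realSymbol.aemeasurable (hUae x)
    filter_upwards [h1, ae_circleParam_realSymbol hD ξ] with w hw hw'
    rw [hw, Function.comp_apply, Function.comp_apply, hw']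
  refine ⟨μ, U, inferInstance, ?_, ?_, ?_, ?_⟩
  · -- total mass
    rw [hμ, Measure.map_apply measurable_realSymbol MeasurableSet.univ, Set.preimage_univ]
    exact normalSpectralMeasure_univ _ _ ξ
  · -- `U ξ = 1`
    have h1 : W.symm ξ = toSpectralL2 N (isStarNormal_resolventNegI hD) ξ
        (f := fun _ => (1 : ℂ)) continuous_const := by
      apply W.injective
      rw [W.apply_symm_apply, hWap]
      exact (cyclicIsometry_toSpectralL2_one _ _ ξ).symm
    have h2 : ((W.symm ξ : Lp ℂ 2 ν) : ℂ → ℂ) =ᵐ[ν] fun _ => (1 : ℂ) := by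
      rw [h1]; exact coeFn_toSpectralL2 _ _ ξ _
    have h3 : ((W.symm ξ : Lp ℂ 2 ν) : ℂ → ℂ) ∘ circleParam =ᵐ[μ] (fun _ => (1 : ℂ)) ∘ circleParam := by
      have : ((W.symm ξ : Lp ℂ 2 ν) : ℂ → ℂ) =ᵐ[μ.map circleParam] fun _ => (1 : ℂ) := by
        rw [(measurePreserving_circleParam hD ξ).map_eq]; exact h2
      exact ae_eq_comp continuous_circleParam.measurable.aemeasurable this
    exact (hUae ξ).trans h3
  · -- clause (a)
    intro x
    constructor
    · intro hx
      set u := W.symm x with hu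
      have hxW : (resolventCyclicIsometry hD ξ u : H) ∈ D.domain := by
        rw [← hWap, hu, W.apply_symm_apply]; exact hx
      have hm := memLp_inv_mul_of_mem_domain hD ξ hWs u hxW
      -- `F(w) = (1/w − i) u(w)` is in `L²(ν)`; compose with `χ`
      have hF : MemLp (fun w => (w⁻¹ - Complex.I) * u w) 2 ν := by
        have := hm.sub ((Lp.memLp u).const_mul Complex.I)
        refine this.ae_eq ?_
        filter_upwards with w
        simp only [Pi.sub_apply, sub_mul]
      have hFχ : MemLp ((fun w => (w⁻¹ - Complex.I) * u w) ∘ circleParam) 2 μ :=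
        hF.comp_measurePreserving (measurePreserving_circleParam hD ξ)
      refine hFχ.ae_eq ?_
      filter_upwards [hUae x] with s hs
      rw [Function.comp_apply, hs, Function.comp_apply, circleParam, inv_inv, add_sub_cancel_right]
    · intro hG
      set u := W.symm x with hu
      -- pull back along `φ`
      have hGφ : MemLp ((fun s : ℝ => (s : ℂ) * ((U x : Lp ℂ 2 μ) : ℝ → ℂ) s) ∘ realSymbol) 2 ν :=
        hG.comp_measurePreserving (measurePreserving_realSymbol hD ξ)
      have hF : MemLp (fun w => (w⁻¹ - Complex.I) * u w) 2 ν := by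
        refine hGφ.ae_eq ?_
        filter_upwards [hpull x, hφae] with w hw hw'
        rw [Function.comp_apply, hw', ← hw, Function.comp_apply]
      have hm : MemLp (fun w => w⁻¹ * u w) 2 ν := by
        have := hF.add ((Lp.memLp u).const_mul Complex.I)
        refine this.ae_eq ?_
        filter_upwards with w
        simp only [Pi.add_apply]; ring
      have := cyclicIsometry_mem_domain_of_memLp hD ξ u hm
      rwa [← hWap, hu, W.apply_symm_apply] at this
  · -- clause (b)
    intro x
    set u := W.symm (x : H) with hu
    have hxW : (resolventCyclicIsometry hD ξ u : H) ∈ D.domain := by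
      rw [← hWap, hu, W.apply_symm_apply]; exact x.2
    have hm := memLp_inv_mul_of_mem_domain hD ξ hWs u hxW
    have hDx : (D x : H) = resolventCyclicIsometry hD ξ (hm.toLp _ - Complex.I • u) := by
      have h1 := map_cyclicIsometry_eq hD ξ u hm hxW
      have h2 : (⟨resolventCyclicIsometry hD ξ u, hxW⟩ : D.domain) = x := by
        apply Subtype.ext
        change resolventCyclicIsometry hD ξ u = x
        rw [← hWap, hu, W.apply_symm_apply]
      rw [h2] at h1
      rw [h1, map_sub, map_smul]
    have hsymm : W.symm (D x : H) = hm.toLp _ - Complex.I • u := by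
      apply W.injective
      rw [W.apply_symm_apply, hWap, hDx]
    have h3 : ((W.symm (D x : H) : Lp ℂ 2 ν) : ℂ → ℂ) =ᵐ[ν] fun w => (w⁻¹ - Complex.I) * u w := by
      rw [hsymm]; exact coeFn_toLp_inv_mul_sub hD ξ u hm
    have h4 : ((W.symm (D x : H) : Lp ℂ 2 ν) : ℂ → ℂ) ∘ circleParam =ᵐ[μ]
        (fun w => (w⁻¹ - Complex.I) * u w) ∘ circleParam := by
      have : ((W.symm (D x : H) : Lp ℂ 2 ν) : ℂ → ℂ) =ᵐ[μ.map circleParam]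
          fun w => (w⁻¹ - Complex.I) * u w := by
        rw [(measurePreserving_circleParam hD ξ).map_eq]; exact h3
      exact ae_eq_comp continuous_circleParam.measurable.aemeasurable this
    filter_upwards [hUae (D x : H), h4, hUae (x : H)] with s hs hs4 hsx
    rw [hs, hs4, hsx, Function.comp_apply, Function.comp_apply, circleParam, inv_inv,
      add_sub_cancel_right]

end Main

end Literature.Analysis.UnboundedOperators
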